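import Summits.HodgeConjecture.CorCM.SimpleCMSurfacePairsHodge
import HarnessLib

/-!
# A simple CM abelian surface and a surface with CM by the REFLEX field: the pair is nondegenerate

COR-CM (cell `pub-hodgecm2`, binder seat `b23` gen 28), count-neutral; NEW as stated, hence under `Summits/`.  Seat
b24's `QuarticCMTypePairNondegenerate` settles two inequivalent types of the SAME non-Galois quartic CM field, this
seat's `SimpleCMSurfacePairsHodge` two quartic CM fields with DIFFERENT Galois closures.  Remaining: two NON-ISOMORPHIC
quartic CM fields `K`, `K'` with the SAME dihedral octic closure `L ⊂ ℂ` (`K' ≅` the reflex field `K^r`).  With the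
embeddings `a, ā, b, b̄` of `K`, the `4`-cycle `τ ∈ Aut(ℂ)` (`τa = b`, `τb = ā`) and the reflection `τ₀` (`τ₀a = a`,
`τ₀b = b̄`) of seat p2: on `L`, `τ² = conj` and `τ₀τ = τ³τ₀`, hence on `Hom(K', ℂ) = {c, d = τc, c̄, d̄}`: `τ²c = c̄` and
`τ₀c ∈ {c, c̄, d, d̄}`.  KEY: `τ₀c = c` would put `c(K')` in the fixed field of `τ₀` on `L`, which is `a(K)` (degrees
`4 ∣ · ∣ 8`, `≠ 8`), forcing `K' ≅ K`; likewise `τ₀c = c̄` via `τ²τ₀` (fixing `b(K)`).  So `τ₀` acts on `Hom(K', ℂ)`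
WITHOUT fixed points, and the balance identities of an `ℕ`-weight on `Hom(K,ℂ) ⊔ Hom(K',ℂ)` at
`1, τ, τ², τ³, τ₀, τ₀τ, τ₀τ², τ₀τ³` force conjugation-invariance (`CMAlgebra.isNondegenerateFamily_iff_forall_nat_symm`).

* `isNondegenerateFamily_pair_of_reflection_free` — the combinatorial core (eight identities, two cases);
* **`isNondegenerateFamily_pair_of_same_closure_of_isEmpty`**, `isNondegenerateFamily_pair_of_normalClosure_eq_of_isEmpty`
  — `K ≇ K'`, same closure: EVERY pair of CM types is a nondegenerate family;
* **`hodgeConjectureFor_prod_surfaces_of_normalClosure_eq_of_isEmpty`** — `B• = D•` and the Hodge conjecture on every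
  `S^a × S'^b`; **`hodgeConjectureFor_prod_simpleSurfaces_of_isEmpty_ringEquiv`** — for ANY two SIMPLE CM abelian
  surfaces with NON-ISOMORPHIC quartic CM fields (different closures: `SimpleCMSurfacePairsHodge`; equal: this file).
  With seat b24's same-field theorem this covers every pair of non-isogenous simple CM abelian surfaces.

Theorems only, no definition, no `sorry`.

## References

* [MoonenZarhin1999LowDim] B. Moonen, Yu. Zarhin, Math. Ann. 315 (1999), "Hodge groups of simple abelian surfaces
  of CM-type" and Cor. (3.9).
* [Shimura1998] G. Shimura, *Abelian Varieties with Complex Multiplication and Modular Functions*, §8.4 Example (2)(C).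
* [Gordon1999HodgeAVSurvey] B. B. Gordon, *A survey of the Hodge conjecture for abelian varieties*, 7.5, §9.2–9.3, 10.10.
-/

noncomputable section

open CategoryTheory CategoryTheory.Limits NumberField NumberField.ComplexEmbedding IntermediateField Module

namespace Summit.HodgeConjecture.CorCM

open Literature.NumberTheory.ComplexMultiplication
open Literature.NumberTheory.ComplexMultiplication.CMTypeOps (mem_iff_conjugate_notMem)
open Literature.AlgebraicGeometry.Motives (AbelianVariety CMType)
open Literature.AlgebraicGeometry.HodgeTheory
open Literature.AlgebraicGeometry.ComplexMultiplication (IsCMTypeRealisation isSimple_iff_isPrimitive)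
open Literature.AlgebraicGeometry.VanGeemen1994 (hodgeClassSpan)
open Literature.AlgebraicGeometry.Pohlmann1968
open Literature.Barriers.HodgeConjecture (divisorClassesSpan)

section Core

variable {I : Type} {K : I → Type} [∀ i, Field (K i)] [∀ i, NumberField (K i)] [∀ i, IsCMField (K i)] [Fintype I]

omit [∀ i, NumberField (K i)] [∀ i, IsCMField (K i)] [Fintype I] in
/-- `Σ_i G(i) = G(i₀) + G(i₁)` on a two-slot index type. [folklore] -/
private theorem sum_eq_add_two {M : Type*} [AddCommMonoid M] [Fintype I] {i₀ i₁ : I} (h01 : i₀ ≠ i₁)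
    (hI : ∀ j, j = i₀ ∨ j = i₁) (G : I → M) : ∑ i, G i = G i₀ + G i₁ := by
  classical
  have huniv : (Finset.univ : Finset I) = {i₀, i₁} := by
    ext j
    simpa using hI j
  rw [huniv, Finset.sum_pair h01]

/-- **The combinatorial core**: two quartic slots; `τ` a `4`-cycle `a ↦ b ↦ ā ↦ b̄` and `τ₀` the reflection fixing
`a, ā` on the first; `τ²c = c̄`, `τ₀τc = τ³τ₀c`, `τ₀c ∈ {τ³c, τc}` (no fixed point) on the second; types `{a, b}`,
`{c, τc}`: the eight balance identities force conjugation-invariance, the family is nondegenerate.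
[cite: MoonenZarhin1999LowDim, "Hodge groups of simple abelian surfaces of CM-type"] [cite: Gordon1999HodgeAVSurvey, §9.2–9.3] -/
theorem isNondegenerateFamily_pair_of_reflection_free {i₀ i₁ : I} (h01 : i₀ ≠ i₁) (hI : ∀ j, j = i₀ ∨ j = i₁)
    (h4₀ : finrank ℚ (K i₀) = 4) (h4₁ : finrank ℚ (K i₁) = 4) {a b : K i₀ →+* ℂ} (hba : b ≠ a)
    (hba' : b ≠ conjugate a) {c : K i₁ →+* ℂ} {τ τ₀ : ℂ ≃+* ℂ} (hτa : τ • a = b) (hτb : τ • b = conjugate a)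
    (hτ₀a : τ₀ • a = a) (hτ₀b : τ₀ • b = conjugate b) (hτc : τ • τ • c = conjugate c)
    (hτ₀τc : τ₀ • τ • c = τ • τ • τ • τ₀ • c) (hτ₀c : τ₀ • c = τ • τ • τ • c ∨ τ₀ • c = τ • c)
    {Φ : ∀ i, CMType (K i)} (hΦ₀ : ∀ s, s ∈ (Φ i₀).1 ↔ s = a ∨ s = b)
    (hΦ₁ : ∀ s, s ∈ (Φ i₁).1 ↔ s = c ∨ s = τ • c) : CMAlgebra.IsNondegenerateFamily Φ := by
  classical
  haveI : Nonempty I := ⟨i₀⟩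
  -- first slot: the four embeddings and the tables
  have hab' : conjugate b ≠ a := fun h => hba' (by rw [← h, involutive_conjugate (K i₀) b])
  have hτa' : τ • conjugate a = conjugate b := by rw [QuarticCM.smul_conjugate, hτa]
  have hτb' : τ • conjugate b = a := by rw [QuarticCM.smul_conjugate, hτb, involutive_conjugate (K i₀) a]
  have hτ₀a' : τ₀ • conjugate a = conjugate a := by rw [QuarticCM.smul_conjugate, hτ₀a]
  have hτ₀b' : τ₀ • conjugate b = b := by rw [QuarticCM.smul_conjugate, hτ₀b, involutive_conjugate (K i₀) b]
  have hΦa : a ∈ (Φ i₀).1 := (hΦ₀ a).2 (Or.inl rfl); have hΦb : b ∈ (Φ i₀).1 := (hΦ₀ b).2 (Or.inr rfl)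
  have hΦna : conjugate a ∉ (Φ i₀).1 := (mem_iff_conjugate_notMem (Φ i₀) a).1 hΦa
  have hΦnb : conjugate b ∉ (Φ i₀).1 := (mem_iff_conjugate_notMem (Φ i₀) b).1 hΦb
  -- second slot: `d = τc`, `τ d = c̄`, `τ c̄ = d̄`, `τ d̄ = c`
  set d : K i₁ →+* ℂ := τ • c with hd
  have hτd : τ • d = conjugate c := hτc
  have hτc' : τ • conjugate c = conjugate d := by rw [QuarticCM.smul_conjugate]
  have hτd' : τ • conjugate d = c := by rw [QuarticCM.smul_conjugate, hτd, involutive_conjugate (K i₁) c]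
  have hdc : d ≠ c := by
    intro h
    have h2 : τ • τ • c = c := by rw [← hd, h, ← hd, h]
    exact QuarticCM.conjugate_ne c (hτc.symm.trans h2)
  have hdc' : d ≠ conjugate c := by
    intro h
    have h1 : τ • conjugate c = conjugate c := by rwa [h] at hτd
    have h2 : τ • c = c := by
      have := congrArg conjugate h1
      rwa [QuarticCM.smul_conjugate, involutive_conjugate (K i₁) (τ • c), involutive_conjugate (K i₁) c] at this
    exact hdc (hd.trans h2)
  have hΦc : c ∈ (Φ i₁).1 := (hΦ₁ c).2 (Or.inl rfl); have hΦd : d ∈ (Φ i₁).1 := (hΦ₁ d).2 (Or.inr rfl)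
  have hΦnc : conjugate c ∉ (Φ i₁).1 := (mem_iff_conjugate_notMem (Φ i₁) c).1 hΦc
  have hΦnd : conjugate d ∉ (Φ i₁).1 := (mem_iff_conjugate_notMem (Φ i₁) d).1 hΦd
  -- `τ³ c = d̄`, `τ³ d = c`, and the relation `τ₀ d = τ³ (τ₀ c)`
  have hτ3c : τ • τ • τ • c = conjugate d := by rw [← hd, hτd, hτc']
  rw [CMAlgebra.isNondegenerateFamily_iff_forall_nat_symm]
  intro f hf
  -- the balance identity, evaluated
  have hsum : ∀ g : ℂ ≃+* ℂ,
      ∑ x : (i : I) × (K i →+* ℂ), (f x : ℚ) * translateInd (CMAlgebra.familyType Φ) g x =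
        (f ⟨i₀, a⟩ : ℚ) * translateInd (Φ i₀).1 g a + f ⟨i₀, conjugate a⟩ * translateInd (Φ i₀).1 g (conjugate a) +
          f ⟨i₀, b⟩ * translateInd (Φ i₀).1 g b + f ⟨i₀, conjugate b⟩ * translateInd (Φ i₀).1 g (conjugate b) +
        ((f ⟨i₁, c⟩ : ℚ) * translateInd (Φ i₁).1 g c + f ⟨i₁, conjugate c⟩ * translateInd (Φ i₁).1 g (conjugate c) +
          f ⟨i₁, d⟩ * translateInd (Φ i₁).1 g d + f ⟨i₁, conjugate d⟩ * translateInd (Φ i₁).1 g (conjugate d)) :=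
    fun g => by
    rw [Fintype.sum_sigma, sum_eq_add_two h01 hI, QuarticCM.sum_eq_add_four h4₀ hba hba',
      QuarticCM.sum_eq_add_four h4₁ hdc hdc']
    simp only [CMAlgebra.translateInd_familyType]
  have htot : ∑ x : (i : I) × (K i →+* ℂ), (f x : ℚ) =
      (f ⟨i₀, a⟩ : ℚ) + f ⟨i₀, conjugate a⟩ + f ⟨i₀, b⟩ + f ⟨i₀, conjugate b⟩ +
        ((f ⟨i₁, c⟩ : ℚ) + f ⟨i₁, conjugate c⟩ + f ⟨i₁, d⟩ + f ⟨i₁, conjugate d⟩) := by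
    rw [Fintype.sum_sigma, sum_eq_add_two h01 hI, QuarticCM.sum_eq_add_four h4₀ hba hba',
      QuarticCM.sum_eq_add_four h4₁ hdc hdc']
  have E1 := hf 1; have E2 := hf τ; have E3 := hf (τ * τ); have E4 := hf (τ * τ * τ)
  have E5 := hf τ₀; have E6 := hf (τ₀ * τ); have E7 := hf (τ₀ * (τ * τ)); have E8 := hf (τ₀ * (τ * τ * τ))
  rw [hsum, htot] at E1 E2 E3 E4 E5 E6 E7 E8
  -- conclude in the two cases for `τ₀ c`
  have key : (f ⟨i₀, conjugate a⟩ : ℚ) = f ⟨i₀, a⟩ ∧ (f ⟨i₀, conjugate b⟩ : ℚ) = f ⟨i₀, b⟩ ∧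
      (f ⟨i₁, conjugate c⟩ : ℚ) = f ⟨i₁, c⟩ ∧ (f ⟨i₁, conjugate d⟩ : ℚ) = f ⟨i₁, d⟩ := by
    rcases hτ₀c with h0 | h0
    · -- `τ₀ c = d̄`, `τ₀ d = c̄`, `τ₀ c̄ = d`, `τ₀ d̄ = c`
      have hτ₀c' : τ₀ • c = conjugate d := h0.trans hτ3c
      have hτ₀d : τ₀ • d = conjugate c := by rw [hd, hτ₀τc, hτ₀c', hτd', ← hd, hτd]
      have hτ₀cc : τ₀ • conjugate c = d := by rw [QuarticCM.smul_conjugate, hτ₀c', involutive_conjugate (K i₁) d]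
      have hτ₀dd : τ₀ • conjugate d = c := by rw [QuarticCM.smul_conjugate, hτ₀d, involutive_conjugate (K i₁) c]
      simp only [translateInd, one_smul, mul_smul, hτa, hτa', hτb, hτb', hτ₀a, hτ₀a', hτ₀b, hτ₀b', ← hd, hτd, hτc',
        hτd', hτ₀c', hτ₀d, hτ₀cc, hτ₀dd, hΦa, hΦb, hΦna, hΦnb, hΦc, hΦd, hΦnc, hΦnd,
        if_true, if_false, mul_one, mul_zero, add_zero, zero_add] at E1 E2 E3 E4 E5 E6 E7 E8
      refine ⟨?_, ?_, ?_, ?_⟩ <;> linarith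
    · -- `τ₀ c = d`, `τ₀ d = c`, `τ₀ c̄ = d̄`, `τ₀ d̄ = c̄`
      have hτ₀c' : τ₀ • c = d := h0.trans hd.symm
      have hτ₀d : τ₀ • d = c := by rw [hd, hτ₀τc, hτ₀c', hd, hτc, hτc', hτd']
      have hτ₀cc : τ₀ • conjugate c = conjugate d := by rw [QuarticCM.smul_conjugate, hτ₀c']
      have hτ₀dd : τ₀ • conjugate d = conjugate c := by rw [QuarticCM.smul_conjugate, hτ₀d]
      simp only [translateInd, one_smul, mul_smul, hτa, hτa', hτb, hτb', hτ₀a, hτ₀a', hτ₀b, hτ₀b', ← hd, hτd, hτc',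
        hτd', hτ₀c', hτ₀d, hτ₀cc, hτ₀dd, hΦa, hΦb, hΦna, hΦnb, hΦc, hΦd, hΦnc, hΦnd,
        if_true, if_false, mul_one, mul_zero, add_zero, zero_add] at E1 E2 E3 E4 E5 E6 E7 E8
      refine ⟨?_, ?_, ?_, ?_⟩ <;> linarith
  obtain ⟨ka, kb, kc, kd⟩ := key
  rintro ⟨i, s⟩
  change f ⟨i, conjugate s⟩ = f ⟨i, s⟩
  rcases hI i with rfl | rfl
  · rcases QuarticCM.eq_or_eq_or_eq_or_eq h4₀ hba hba' s with rfl | rfl | rfl | rfl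
    · exact_mod_cast ka
    · rw [involutive_conjugate (K i) a]; exact_mod_cast ka.symm
    · exact_mod_cast kb
    · rw [involutive_conjugate (K i) b]; exact_mod_cast kb.symm
  · rcases QuarticCM.eq_or_eq_or_eq_or_eq h4₁ hdc hdc' s with rfl | rfl | rfl | rfl
    · exact_mod_cast kc
    · rw [involutive_conjugate (K i) c]; exact_mod_cast kc.symm
    · exact_mod_cast kd
    · rw [involutive_conjugate (K i) d]; exact_mod_cast kd.symm

end Core

/-! ### A non-Galois quartic CM field and a non-isomorphic partner in the same closure -/
section Dress

variable {I : Type} {K : I → Type} [∀ i, Field (K i)] [∀ i, NumberField (K i)] [∀ i, IsCMField (K i)] [Fintype I]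

omit [∀ i, IsCMField (K i)] [Fintype I] in
/-- Two automorphisms of `ℂ` agreeing on every embedding of `K_{i₀}` agree on every embedding of a field `K_{i₁}` all
of whose embeddings take values in `L_{i₀}`. [folklore] -/
private theorem smul_eq_smul_of_forall_smul_eq {i₀ i₁ : I} {σ σ' : ℂ ≃+* ℂ}
    (h : ∀ s : K i₀ →+* ℂ, σ • s = σ' • s)
    (hL : ∀ (s' : K i₁ →+* ℂ) (x : K i₁), s' x ∈ normalClosure ℚ (K i₀) ℂ) (s' : K i₁ →+* ℂ) :
    σ • s' = σ' • s' :=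
  RingHom.ext fun x => apply_eq_of_forall_smul_eq i₀ h (hL s' x)

omit [Fintype I] in
/-- A subfield of a finite extension (inside `ℂ`) is finite. [folklore] -/
private theorem finiteDimensional_of_le₉ {E E' : IntermediateField ℚ ℂ} [FiniteDimensional ℚ E] (h : E' ≤ E) :
    FiniteDimensional ℚ E' :=
  FiniteDimensional.of_injective (IntermediateField.inclusion h).toLinearMap (IntermediateField.inclusion_injective h)

omit [Fintype I] in
/-- If `σ ∈ Aut(ℂ)` fixes an embedding `s` of the non-Galois quartic CM field `K_{i₀}` but moves another, and fixes an
embedding `c` of a quartic `K_{i₁}` valued in `L_{i₀}`, then `K_{i₀} ≅ K_{i₁}`: `s(K_{i₀}) = L_{i₀} ∩ Fix(σ) = c(K_{i₁})`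
(degree `4` inside the octic `L_{i₀}`). [cite: Shimura1998, §8.4 Example (2)(C)] -/
private theorem nonempty_ringEquiv_of_smul_eq_self {i₀ i₁ : I} (h4₀ : finrank ℚ (K i₀) = 4)
    (hK₀ : ¬ IsGalois ℚ (K i₀)) (h4₁ : finrank ℚ (K i₁) = 4) {σ : ℂ ≃+* ℂ} {s s₂ : K i₀ →+* ℂ} (hs : σ • s = s)
    (hs₂ : σ • s₂ ≠ s₂) {c : K i₁ →+* ℂ} (hc : σ • c = c)
    (hL : ∀ (s' : K i₁ →+* ℂ) (x : K i₁), s' x ∈ normalClosure ℚ (K i₀) ℂ) : Nonempty (K i₀ ≃+* K i₁) := by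
  -- the fixed field of `σ` inside `L₀`
  let Fixσ : IntermediateField ℚ ℂ :=
    (RingHom.eqLocusField σ.toRingHom (RingHom.id ℂ)).toIntermediateField fun q => by
      rw [RingHom.mem_eqLocusField, RingHom.id_apply, eq_ratCast, RingEquiv.toRingHom_eq_coe, RingEquiv.coe_toRingHom,
        map_ratCast]
  let F : IntermediateField ℚ ℂ := normalClosure ℚ (K i₀) ℂ ⊓ Fixσ
  haveI : FiniteDimensional ℚ ↥F := finiteDimensional_of_le₉ inf_le_left
  have hsF : s.toRatAlgHom.fieldRange ≤ F := by
    rintro _ ⟨x, rfl⟩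
    refine IntermediateField.mem_inf.2 ⟨apply_mem_normalClosure i₀ s x, ?_⟩
    change σ.toRingHom (s x) = RingHom.id ℂ (s x)
    rw [RingHom.id_apply, RingEquiv.toRingHom_eq_coe, RingEquiv.coe_toRingHom]
    exact RingHom.congr_fun hs x
  have hcF : c.toRatAlgHom.fieldRange ≤ F := by
    rintro _ ⟨x, rfl⟩
    refine IntermediateField.mem_inf.2 ⟨hL c x, ?_⟩
    change σ.toRingHom (c x) = RingHom.id ℂ (c x)
    rw [RingHom.id_apply, RingEquiv.toRingHom_eq_coe, RingEquiv.coe_toRingHom]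
    exact RingHom.congr_fun hc x
  have hFne : F ≠ normalClosure ℚ (K i₀) ℂ := by
    intro hF
    apply hs₂
    refine RingHom.ext fun x => ?_
    have hx : s₂ x ∈ F := hF ▸ apply_mem_normalClosure i₀ s₂ x
    have hx' : σ.toRingHom (s₂ x) = RingHom.id ℂ (s₂ x) := (IntermediateField.mem_inf.1 hx).2
    rw [RingHom.id_apply, RingEquiv.toRingHom_eq_coe, RingEquiv.coe_toRingHom] at hx'
    exact hx'
  -- degrees: `4 ∣ [F : ℚ] ∣ 8`, `[F : ℚ] ≠ 8`, so `[F : ℚ] = 4 = [s(K₀) : ℚ] = [c(K₁) : ℚ]`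
  have h8 : finrank ℚ ↥(normalClosure ℚ (K i₀) ℂ) = 8 := finrank_normalClosure_complex_eq_eight i₀ h4₀ hK₀
  have hF8 : finrank ℚ ↥F ∣ 8 := h8 ▸ IntermediateField.finrank_dvd_of_le_right inf_le_left
  have h4s : finrank ℚ ↥s.toRatAlgHom.fieldRange = 4 := by
    rw [← h4₀]; exact (AlgEquiv.ofInjectiveField s.toRatAlgHom).toLinearEquiv.finrank_eq.symm
  have h4c : finrank ℚ ↥c.toRatAlgHom.fieldRange = 4 := by
    rw [← h4₁]; exact (AlgEquiv.ofInjectiveField c.toRatAlgHom).toLinearEquiv.finrank_eq.symm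
  have h4F : 4 ∣ finrank ℚ ↥F := h4s ▸ IntermediateField.finrank_dvd_of_le_right hsF
  have hFne8 : finrank ℚ ↥F ≠ 8 := fun h => hFne (IntermediateField.eq_of_le_of_finrank_eq inf_le_left (by rw [h, h8]))
  have hF4 : finrank ℚ ↥F = 4 := by
    obtain ⟨k, hk⟩ := h4F
    have hk2 : k ∣ 2 := by
      have : 4 * k ∣ 4 * 2 := by rw [← hk]; exact hF8
      exact Nat.dvd_of_mul_dvd_mul_left (by norm_num) this
    rcases (Nat.dvd_prime Nat.prime_two).1 hk2 with rfl | rfl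
    · rw [hk]
    · exact absurd (by rw [hk]) hFne8
  have hsF' : s.toRatAlgHom.fieldRange = F := IntermediateField.eq_of_le_of_finrank_eq hsF (by rw [h4s, hF4])
  have hcF' : c.toRatAlgHom.fieldRange = F := IntermediateField.eq_of_le_of_finrank_eq hcF (by rw [h4c, hF4])
  exact ⟨((AlgEquiv.ofInjectiveField s.toRatAlgHom).trans
    ((IntermediateField.equivOfEq (hsF'.trans hcF'.symm)).trans (AlgEquiv.ofInjectiveField c.toRatAlgHom).symm)).toRingEquiv⟩

/-- **A non-Galois quartic CM field and a non-isomorphic quartic CM field with the same Galois closure: every pair of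
CM types is a NONDEGENERATE family** (a simple CM surface and one with CM by the reflex field): the reflection `τ₀`
fixing `a(K_{i₀})` acts without fixed points on `Hom(K_{i₁}, ℂ)`, and the eight balance identities apply.
[cite: MoonenZarhin1999LowDim, "Hodge groups of simple abelian surfaces of CM-type"] [cite: Shimura1998, §8.4 Example (2)(C)] -/
theorem isNondegenerateFamily_pair_of_same_closure_of_isEmpty {i₀ i₁ : I} (h01 : i₀ ≠ i₁)
    (hI : ∀ j, j = i₀ ∨ j = i₁) (h4₀ : finrank ℚ (K i₀) = 4) (hK₀ : ¬ IsGalois ℚ (K i₀))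
    (h4₁ : finrank ℚ (K i₁) = 4) (hL : ∀ (s' : K i₁ →+* ℂ) (x : K i₁), s' x ∈ normalClosure ℚ (K i₀) ℂ)
    (hKK : IsEmpty (K i₀ ≃+* K i₁)) (Φ : ∀ i, CMType (K i)) : CMAlgebra.IsNondegenerateFamily Φ := by
  -- slot `i₀`: the type `{a, b}`, the `4`-cycle `τ` and the reflection `τ₀`
  obtain ⟨a, b, hba, hba', hΦ₀⟩ := QuarticCM.exists_mem_mem_ne h4₀ (Φ i₀)
  obtain ⟨τ, hτa, hτb⟩ := QuarticCM.exists_ringAut_smul_eq_smul_eq_conjugate h4₀ hK₀ hba hba'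
  obtain ⟨τ₀, hτ₀a, hτ₀b⟩ := QuarticCM.exists_ringAut_smul_eq_self_smul_eq_conjugate_of_not_isGalois h4₀ hK₀ hba hba'
  have hτa' : τ • conjugate a = conjugate b := by rw [QuarticCM.smul_conjugate, hτa]
  have hτb' : τ • conjugate b = a := by rw [QuarticCM.smul_conjugate, hτb, involutive_conjugate (K i₀) a]
  have hτ₀a' : τ₀ • conjugate a = conjugate a := by rw [QuarticCM.smul_conjugate, hτ₀a]
  have hτ₀b' : τ₀ • conjugate b = b := by rw [QuarticCM.smul_conjugate, hτ₀b, involutive_conjugate (K i₀) b]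
  -- relations on the embeddings of `K_{i₀}`: `τ² = conj`, `τ₀τ = τ³τ₀`
  have h1 : ∀ s : K i₀ →+* ℂ, (τ * τ) • s = (starRingAut : ℂ ≃+* ℂ) • s := by
    intro s
    rw [mul_smul, conj_smul_eq_conjugate]
    rcases QuarticCM.eq_or_eq_or_eq_or_eq h4₀ hba hba' s with rfl | rfl | rfl | rfl
    · rw [hτa, hτb]
    · rw [hτa', hτb', involutive_conjugate (K i₀) a]
    · rw [hτb, hτa']
    · rw [hτb', hτa, involutive_conjugate (K i₀) b]
  have h2 : ∀ s : K i₀ →+* ℂ, (τ₀ * τ) • s = (τ * τ * τ * τ₀) • s := by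
    intro s
    simp only [mul_smul]
    rcases QuarticCM.eq_or_eq_or_eq_or_eq h4₀ hba hba' s with rfl | rfl | rfl | rfl
    · rw [hτa, hτ₀b, hτ₀a, hτa, hτb, hτa']
    · rw [hτa', hτ₀b', hτ₀a', hτa', hτb', hτa]
    · rw [hτb, hτ₀a', hτ₀b, hτb', hτa, hτb]
    · rw [hτb', hτ₀a, hτ₀b', hτb, hτa', hτb']
  -- transferred to the embeddings of `K_{i₁}` (valued in `L₀`)
  have g1 : ∀ s' : K i₁ →+* ℂ, τ • τ • s' = conjugate s' := fun s' => by
    have h := smul_eq_smul_of_forall_smul_eq h1 hL s'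
    rwa [mul_smul, conj_smul_eq_conjugate] at h
  have g2 : ∀ s' : K i₁ →+* ℂ, τ₀ • τ • s' = τ • τ • τ • τ₀ • s' := fun s' => by
    have h := smul_eq_smul_of_forall_smul_eq h2 hL s'
    simpa only [mul_smul] using h
  -- slot `i₁`: write the type as `{c, τc}`
  obtain ⟨c', d', hdc, hdc', hΦ₁'⟩ := QuarticCM.exists_mem_mem_ne h4₁ (Φ i₁)
  have hc : ∃ c : K i₁ →+* ℂ, ∀ s, s ∈ (Φ i₁).1 ↔ s = c ∨ s = τ • c := by
    rcases QuarticCM.eq_or_eq_or_eq_or_eq h4₁ hdc hdc' (τ • c') with h | h | h | h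
    · exfalso
      have h2' : τ • τ • c' = c' := by rw [h, h]
      exact QuarticCM.conjugate_ne c' ((g1 c').symm.trans h2')
    · exfalso
      have h2' : τ • τ • c' = c' := by
        rw [h, QuarticCM.smul_conjugate, h, involutive_conjugate (K i₁) c']
      exact QuarticCM.conjugate_ne c' ((g1 c').symm.trans h2')
    · exact ⟨c', fun s => by rw [hΦ₁' s, h]⟩
    · have hτd' : τ • d' = c' := by
        have h2' : τ • τ • c' = conjugate (τ • d') := by rw [h, QuarticCM.smul_conjugate]
        exact ((involutive_conjugate (K i₁)).injective ((g1 c').symm.trans h2')).symm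
      exact ⟨d', fun s => by rw [hΦ₁' s, hτd']; tauto⟩
  obtain ⟨c, hΦ₁⟩ := hc
  have hτc : τ • τ • c = conjugate c := g1 c
  have hdc1 : τ • c ≠ c := by
    intro h
    have h2' : τ • τ • c = c := by rw [h, h]
    exact QuarticCM.conjugate_ne c (hτc.symm.trans h2')
  have hdc1' : τ • c ≠ conjugate c := by
    intro h
    have h2' : τ • τ • c = c := by rw [h, QuarticCM.smul_conjugate, h, involutive_conjugate (K i₁) c]
    exact QuarticCM.conjugate_ne c (hτc.symm.trans h2')
  -- `τ₀ c ∈ {c, c̄, τc, τ³c}`; the first two would make `K_{i₁} ≅ K_{i₀}`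
  rcases QuarticCM.eq_or_eq_or_eq_or_eq h4₁ hdc1 hdc1' (τ₀ • c) with h | h | h | h
  · have hτ₀b'' : τ₀ • b ≠ b := by rw [hτ₀b]; exact QuarticCM.conjugate_ne b
    exact (hKK.false (Classical.choice (nonempty_ringEquiv_of_smul_eq_self h4₀ hK₀ h4₁ hτ₀a hτ₀b'' h hL))).elim
  · -- `σ = τ²τ₀` fixes `b` and `c`, moves `a`
    have hσb : (τ * τ * τ₀) • b = b := by rw [mul_smul, mul_smul, hτ₀b, hτb', hτa]
    have hσa : (τ * τ * τ₀) • a ≠ a := by rw [mul_smul, mul_smul, hτ₀a, hτa, hτb]; exact QuarticCM.conjugate_ne a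
    have hσc : (τ * τ * τ₀) • c = c := by
      rw [mul_smul, mul_smul, h, QuarticCM.smul_conjugate, QuarticCM.smul_conjugate, hτc,
        involutive_conjugate (K i₁) c]
    exact (hKK.false (Classical.choice (nonempty_ringEquiv_of_smul_eq_self h4₀ hK₀ h4₁ hσb hσa hσc hL))).elim
  · exact isNondegenerateFamily_pair_of_reflection_free h01 hI h4₀ h4₁ hba hba' hτa hτb hτ₀a hτ₀b hτc (g2 c)
      (Or.inr h) hΦ₀ hΦ₁
  · exact isNondegenerateFamily_pair_of_reflection_free h01 hI h4₀ h4₁ hba hba' hτa hτb hτ₀a hτ₀b hτc (g2 c)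
      (Or.inl (h.trans (g1 (τ • c)).symm)) hΦ₀ hΦ₁

/-- **Non-isomorphic quartic CM fields with `L₀ = L₁`: every pair of types is nondegenerate** (a Galois `K_{i₀}` is
excluded: `L₀ = ι(K_{i₀})` would be the image of `K_{i₁}`). [cite: MoonenZarhin1999LowDim, "Hodge groups of simple abelian surfaces of CM-type"] -/
theorem isNondegenerateFamily_pair_of_normalClosure_eq_of_isEmpty {i₀ i₁ : I} (h01 : i₀ ≠ i₁)
    (hI : ∀ j, j = i₀ ∨ j = i₁) (h4₀ : finrank ℚ (K i₀) = 4) (h4₁ : finrank ℚ (K i₁) = 4)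
    (hL : normalClosure ℚ (K i₀) ℂ = normalClosure ℚ (K i₁) ℂ) (hKK : IsEmpty (K i₀ ≃+* K i₁))
    (Φ : ∀ i, CMType (K i)) : CMAlgebra.IsNondegenerateFamily Φ := by
  have hL' : ∀ (s' : K i₁ →+* ℂ) (x : K i₁), s' x ∈ normalClosure ℚ (K i₀) ℂ := fun s' x =>
    hL ▸ apply_mem_normalClosure i₁ s' x
  by_cases hK₀ : IsGalois ℚ (K i₀)
  · -- `L₀ = s₀(K₀)` has degree `4` and contains `s₁(K₁)` of degree `4`: the fields are isomorphic
    exfalso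
    obtain ⟨s₀⟩ : Nonempty (K i₀ →+* ℂ) := inferInstance
    obtain ⟨s₁⟩ : Nonempty (K i₁ →+* ℂ) := inferInstance
    have hle : s₁.toRatAlgHom.fieldRange ≤ s₀.toRatAlgHom.fieldRange := by
      rw [← normalClosure_eq_fieldRange_of_normal s₀.toRatAlgHom]
      rintro _ ⟨x, rfl⟩
      exact hL' s₁ x
    haveI : FiniteDimensional ℚ ↥s₀.toRatAlgHom.fieldRange :=
      finiteDimensional_of_le₉ (AlgHom.fieldRange_le_normalClosure s₀.toRatAlgHom)
    have h4s₀ : finrank ℚ ↥s₀.toRatAlgHom.fieldRange = 4 := by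
      rw [← h4₀]; exact (AlgEquiv.ofInjectiveField s₀.toRatAlgHom).toLinearEquiv.finrank_eq.symm
    have h4s₁ : finrank ℚ ↥s₁.toRatAlgHom.fieldRange = 4 := by
      rw [← h4₁]; exact (AlgEquiv.ofInjectiveField s₁.toRatAlgHom).toLinearEquiv.finrank_eq.symm
    have heq : s₁.toRatAlgHom.fieldRange = s₀.toRatAlgHom.fieldRange :=
      IntermediateField.eq_of_le_of_finrank_eq hle (by rw [h4s₀, h4s₁])
    exact hKK.false ((AlgEquiv.ofInjectiveField s₀.toRatAlgHom).trans
      ((IntermediateField.equivOfEq heq.symm).trans (AlgEquiv.ofInjectiveField s₁.toRatAlgHom).symm)).toRingEquiv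
  · exact isNondegenerateFamily_pair_of_same_closure_of_isEmpty h01 hI h4₀ hK₀ h4₁ hL' hKK Φ

end Dress

/-! ### Abelian surfaces -/

section Geometry

variable {I : Type} {K : I → Type} [∀ i, Field (K i)] [∀ i, NumberField (K i)] [∀ i, IsCMField (K i)] [Fintype I]
  [Nonempty I] {Φ : ∀ i, CMType (K i)}
variable {A : I → AbelianVariety ℂ} {ι : ∀ i, 𝓞 (K i) →+* End (A i)}
  {θ : ∀ i, K i →+* Module.End ℂ (complexBetti (A i).X 1)}

/-- **A surface with CM by `K` and one with CM by a non-isomorphic field with the same closure (the reflex field):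
the Hodge conjecture and `B• = D•` on every `S^a × S'^b`**, all types, UNCONDITIONALLY.
[cite: MoonenZarhin1999LowDim, "Hodge groups of simple abelian surfaces of CM-type"] [cite: Gordon1999HodgeAVSurvey, 7.5 and 10.10] -/
theorem hodgeConjectureFor_prod_surfaces_of_normalClosure_eq_of_isEmpty {i₀ i₁ : I} (h01 : i₀ ≠ i₁)
    (hI : ∀ j, j = i₀ ∨ j = i₁) (h4₀ : finrank ℚ (K i₀) = 4) (h4₁ : finrank ℚ (K i₁) = 4)
    (hL : normalClosure ℚ (K i₀) ℂ = normalClosure ℚ (K i₁) ℂ) (hKK : IsEmpty (K i₀ ≃+* K i₁))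
    (hA : ∀ i, IsCMTypeRealisation (Φ i) (A i) (ι i) (θ i)) {N : ℕ} (π : Fin N → I) :
    HodgeConjectureFor (⨁ fun j : Fin N => A (π j)).dim (⨁ fun j : Fin N => A (π j)).X ∧
      ∀ m : ℕ, hodgeClassSpan (⨁ fun j : Fin N => A (π j)).dim (⨁ fun j : Fin N => A (π j)).X m =
        divisorClassesSpan (⨁ fun j : Fin N => A (π j)).X (⨁ fun j : Fin N => A (π j)).dim m :=
  have hnd := isNondegenerateFamily_pair_of_normalClosure_eq_of_isEmpty h01 hI h4₀ h4₁ hL hKK Φ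
  ⟨hnd.hodgeConjectureFor_prod hA π, fun m => hnd.hodgeClassSpan_prod_eq_divisorClassesSpan hA π m⟩

/-- **Any two SIMPLE CM abelian surfaces with NON-ISOMORPHIC CM fields: the Hodge conjecture and `B• = D•` on every
`S₀^a × S₁^b`**, UNCONDITIONALLY (different closures: `SimpleCMSurfacePairsHodge`; equal: the reflex pair; isomorphic
fields with inequivalent types: seat b24). [cite: MoonenZarhin1999LowDim, "Hodge groups of simple abelian surfaces of CM-type" and Cor. (3.9)] -/
theorem hodgeConjectureFor_prod_simpleSurfaces_of_isEmpty_ringEquiv {i₀ i₁ : I} (h01 : i₀ ≠ i₁)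
    (hI : ∀ j, j = i₀ ∨ j = i₁) (h4 : ∀ i, finrank ℚ (K i) = 4) (hKK : IsEmpty (K i₀ ≃+* K i₁))
    (hA : ∀ i, IsCMTypeRealisation (Φ i) (A i) (ι i) (θ i)) (hS : ∀ i, (A i).IsSimple) {N : ℕ} (π : Fin N → I) :
    HodgeConjectureFor (⨁ fun j : Fin N => A (π j)).dim (⨁ fun j : Fin N => A (π j)).X ∧
      ∀ m : ℕ, hodgeClassSpan (⨁ fun j : Fin N => A (π j)).dim (⨁ fun j : Fin N => A (π j)).X m =
        divisorClassesSpan (⨁ fun j : Fin N => A (π j)).X (⨁ fun j : Fin N => A (π j)).dim m := by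
  by_cases hne : normalClosure ℚ (K i₀) ℂ = normalClosure ℚ (K i₁) ℂ
  · exact hodgeConjectureFor_prod_surfaces_of_normalClosure_eq_of_isEmpty h01 hI (h4 i₀) (h4 i₁) hne hKK hA π
  · exact hodgeConjectureFor_prod_simpleSurfaces_of_normalClosure_ne h01 hI h4 hne hA hS π

end Geometry



end Summit.HodgeConjecture.CorCM

end
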